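import Summits.BirchSwinnertonDyer.BirchSwinnertonDyer.Theorems.ResidualThetaTransportAtTwoSignedMuSeedAtTwoPlusJetRobertLevelOne
import Summits.BirchSwinnertonDyer.BirchSwinnertonDyer.Theorems.ResidualThetaTransportAtTwoSignedMuSeedAtTwoPlusJetInverse
import HarnessLib

/-!
# The HONEST `𝔣₀ ≠ 1` Robert function `θ̄ = ∏ᵢ 1/(x(t ⊕ Qᵢ) − x(Pᵢ))`: Riccati, `E₀ = Σ eᵢ`, the level-0 dichotomy `v(S₀) ∈ {0} ∪ [4, ∞)` and the
# level-1 wall — stubs J3 + J4 of `jet-character-sums` as ONE kernel statement for an unweighted product (no twist/weight convention enters)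
# (seed lines `jet-character-sums` / `norm-field-tilt`; crux `SignedMuSeedAtTwoPlus` stmt-BirchSwinnertonDyer-21438; Kμ⁺ stmt-BirchSwinnertonDyer-20689)

Cell `bsd-wall`, width seat `bsd-wall-rtt-p4-w2` g14 (`--supports`, closes nothing).  THEOREMS ONLY; the lines are NOT registered (W-79);
BSD is not proved by this.

Data (any commutative ring `R` of characteristic `2`, tilt curve `w = formalW` of `y² + y = x³`): a finite family `i ∈ s` of translated Robert factors —
translation points `(xᵢ, yᵢ)` (the `[c]Q̃`, `c ∈ ker χ₀`; NO curve equation needed), pole differences `dᵢ = xᵢ − x(Pᵢ)` with inverses `eᵢ`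
(`dᵢeᵢ = 1`), quotients `qᵢ·(t + xᵢw)² = w(1 + xᵢ²t + yᵢ²w)` (`qᵢ = x(Qᵢ ⊕ T(t)) − xᵢ`, `…JetTranslation`) and factors `φᵢ·(dᵢ + qᵢ) = 1`
(`φᵢ = 1/(x(t ⊕ Qᵢ) − x(Pᵢ))`).  `Φ := Σᵢ φᵢ = D log ∏ᵢ φᵢ` (`…JetRobertRiccati.prod_mul_sum_eq_derivative_prod`), `S₀ := λΦ(λt) + λ²Φ(λ²t)`.

* §1 `X_pow_eight_dvd_translationQuotient_sub` (EVERY solution `q` of the quadratic relation has the 8-jet `t + x²t² + (1+y²)t⁴ + x⁴t⁶`, by uniqueness),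
  `derivative_translatedFactor` (`φᵢ' = φᵢ²`), `coeff_zero/one/three_translatedFactor` (`e`, `e²`, `e⁴`).
* §2 `derivative_translatedSum`, **`coeff_zero_translatedSum`** (`E₀ := [t⁰]Φ = Σᵢ eᵢ`), `coeff_one_translatedSum` (`= E₀²`), `coeff_three_translatedSum` (`= E₀⁴`)
  — the Frobenius collapses `T₁ = E₀²`, `T₃ = E₀⁴` for the UNWEIGHTED sum (no `χ̄₀`-weights: the honest product has none).
* §3 **`levelZero_translatedRobert`**: `S₀' = S₀²`; `E₀ ≠ 0 ⟹ [t⁰]S₀ ≠ 0` (`v(S₀) = 0 < 4¹ − 2`: `NonDeg(0)`); `E₀ = 0 ⟹ t⁴ ∣ S₀`.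
* §4 **`levelOne_translatedRobert`** (on `E₀ = 0`, `δ ≡ ūt⁴ (mod t⁸)`): `t¹² ∣ S₁`, `[t¹²]S₁ = ūT₄² + ū²T₆`, `[t¹³]S₁ = 0`, `ūT₄² + ū²T₆ = 0 ⟹ t¹⁴ ∣ S₁`, with
  `T₄ = Σᵢ (eᵢ⁵ + aᵢeᵢ⁴ + aᵢ²eᵢ³ + (1+bᵢ)eᵢ²)`, `T₆ = Σᵢ (eᵢ⁷ + aᵢeᵢ⁶ + (aᵢ³+1+bᵢ)eᵢ⁴ + aᵢ²eᵢ²)`, `aᵢ = xᵢ²`, `bᵢ = yᵢ²` (`…JetInverse.coeff_inv_jet`).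

So for the honest product the J3/J4 chain is: `NonDeg(0) ⟺ Σᵢ 1/(xᵢ − x(Pᵢ)) ≠ 0`, else `NonDeg(1) ⟺ ūT₄² + ū²T₆ ≠ 0` — with NO convention caveat
(the caveat of the card concerns re-expressing a `ρ`-product of such honest products through `χ̄₀`-weights). [folklore]
-/

set_option autoImplicit false
-- the Theorems namespace of this sub repeats the summit name by design (D-0017 nested layout)
set_option linter.dupNamespace false

noncomputable section

open PowerSeries Finset

namespace Summit.BirchSwinnertonDyer.BirchSwinnertonDyer.Theorems.SignedMuAtTwo.JetCharacterSums

variable {R : Type*} [CommRing R] [CharP R 2]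

/-! ## §1 One translated factor -/

section Factor

/-- **Every** solution `q` of `q·(t + x w)² = w(1 + x²t + y²w)` has the 8-jet `q ≡ t + x²t² + (1 + y²)t⁴ + x⁴t⁶ (mod t⁸)` (the solution is unique:
cancel `t + x w = t·unit` twice; `…JetTranslation.translationJet` gives one with the jet). [cite: SilvermanAEC2009, IV.1.1] -/
theorem X_pow_eight_dvd_translationQuotient_sub (x y : R) {q : R⟦X⟧}
    (hq : q * (X + C x * (⟨0, 0, 1, 0, 0⟩ : WeierstrassCurve R).formalW) ^ 2 =
      (⟨0, 0, 1, 0, 0⟩ : WeierstrassCurve R).formalW * (1 + C (x ^ 2) * X + C (y ^ 2) * (⟨0, 0, 1, 0, 0⟩ : WeierstrassCurve R).formalW)) :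
    (X : R⟦X⟧) ^ 8 ∣ q - (X + C (x ^ 2) * X ^ 2 + C (1 + y ^ 2) * X ^ 4 + C (x ^ 4) * X ^ 6) := by
  obtain ⟨q', hq', hj⟩ := translationJet R x y
  have h2 : q * (X + C x * (⟨0, 0, 1, 0, 0⟩ : WeierstrassCurve R).formalW) * (X + C x * (⟨0, 0, 1, 0, 0⟩ : WeierstrassCurve R).formalW) =
      q' * (X + C x * (⟨0, 0, 1, 0, 0⟩ : WeierstrassCurve R).formalW) * (X + C x * (⟨0, 0, 1, 0, 0⟩ : WeierstrassCurve R).formalW) := by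
    rw [mul_assoc, ← sq, hq, mul_assoc, ← sq, hq']
  have he : q = q' := mul_robertDen_cancel (mul_robertDen_cancel h2)
  rw [he]; exact hj

variable {x y d e : R} (hde : d * e = 1) {q φ : R⟦X⟧}
  (hq : q * (X + C x * (⟨0, 0, 1, 0, 0⟩ : WeierstrassCurve R).formalW) ^ 2 =
    (⟨0, 0, 1, 0, 0⟩ : WeierstrassCurve R).formalW * (1 + C (x ^ 2) * X + C (y ^ 2) * (⟨0, 0, 1, 0, 0⟩ : WeierstrassCurve R).formalW))
  (hφ : φ * (C d + q) = 1)

include hq hφ in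
/-- **`φ' = φ²`** for the translated Robert factor `φ = 1/(x(t ⊕ Q) − x(P))` (`q' = 1`, `…JetRobertRiccati`). [folklore] -/
theorem derivative_translatedFactor : d⁄dX R φ = φ ^ 2 :=
  derivative_eq_sq_of_mul_eq_one (derivative_translationQuotient x y hq) hφ

include hde hq hφ in
/-- `[t⁰]φ = e`, `[t¹]φ = e²`, `[t³]φ = e⁴` (`e = 1/(x(Q) − x(P))`; `…JetInverse.coeff_inv_jet`). [folklore] -/
theorem coeff_translatedFactor : coeff 0 φ = e ∧ coeff 1 φ = e ^ 2 ∧ coeff 3 φ = e ^ 4 := by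
  have hq8 := X_pow_eight_dvd_translationQuotient_sub x y hq
  rw [show x ^ 4 = (x ^ 2) ^ 2 by ring] at hq8
  obtain ⟨h0, h1, -, h3, -⟩ := coeff_inv_jet hde hq8 hφ
  exact ⟨h0, h1, h3⟩

include hde hq hφ in
/-- `[t⁴]φ` and `[t⁶]φ` in closed form (`a = x²`, `b = y²`). [folklore] -/
theorem coeff_four_six_translatedFactor :
    coeff 4 φ = e ^ 5 + x ^ 2 * e ^ 4 + (x ^ 2) ^ 2 * e ^ 3 + (1 + y ^ 2) * e ^ 2 ∧
      coeff 6 φ = e ^ 7 + x ^ 2 * e ^ 6 + ((x ^ 2) ^ 3 + 1 + y ^ 2) * e ^ 4 + (x ^ 2) ^ 2 * e ^ 2 := by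
  have hq8 := X_pow_eight_dvd_translationQuotient_sub x y hq
  rw [show x ^ 4 = (x ^ 2) ^ 2 by ring] at hq8
  obtain ⟨-, -, -, -, h4, -, h6, -⟩ := coeff_inv_jet hde hq8 hφ
  exact ⟨h4, h6⟩

end Factor

/-! ## §2 The honest sum `Φ = Σᵢ φᵢ` -/

section Sum

variable {ι : Type*} {s : Finset ι} {x y d e : ι → R} {q φ : ι → R⟦X⟧}
  (hde : ∀ i ∈ s, d i * e i = 1)
  (hq : ∀ i ∈ s, q i * (X + C (x i) * (⟨0, 0, 1, 0, 0⟩ : WeierstrassCurve R).formalW) ^ 2 =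
    (⟨0, 0, 1, 0, 0⟩ : WeierstrassCurve R).formalW * (1 + C (x i ^ 2) * X + C (y i ^ 2) * (⟨0, 0, 1, 0, 0⟩ : WeierstrassCurve R).formalW))
  (hφ : ∀ i ∈ s, φ i * (C (d i) + q i) = 1)

include hq hφ in
/-- `Φ' = Φ²`. [folklore] -/
theorem derivative_translatedSum : d⁄dX R (∑ i ∈ s, φ i) = (∑ i ∈ s, φ i) ^ 2 :=
  riccati_sum s φ fun i hi => derivative_translatedFactor (hq i hi) (hφ i hi)

include hde hq hφ in
/-- **`E₀ := [t⁰]Φ = Σᵢ eᵢ`** (`eᵢ = 1/(x(Qᵢ) − x(Pᵢ))`). [folklore] -/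
theorem coeff_zero_translatedSum : coeff 0 (∑ i ∈ s, φ i) = ∑ i ∈ s, e i := by
  rw [map_sum]; exact Finset.sum_congr rfl fun i hi => (coeff_translatedFactor (hde i hi) (hq i hi) (hφ i hi)).1

include hde hq hφ in
/-- `[t¹]Φ = E₀²` (Frobenius, unweighted sum). [folklore] -/
theorem coeff_one_translatedSum : coeff 1 (∑ i ∈ s, φ i) = (∑ i ∈ s, e i) ^ 2 := by
  rw [map_sum, sum_pow_char 2 s e]
  exact Finset.sum_congr rfl fun i hi => (coeff_translatedFactor (hde i hi) (hq i hi) (hφ i hi)).2.1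

include hde hq hφ in
/-- `[t³]Φ = E₀⁴`. [folklore] -/
theorem coeff_three_translatedSum : coeff 3 (∑ i ∈ s, φ i) = (∑ i ∈ s, e i) ^ 4 := by
  have h4 : (∑ i ∈ s, e i) ^ 4 = ∑ i ∈ s, e i ^ 4 := by
    rw [show (4 : ℕ) = 2 * 2 from rfl, pow_mul, sum_pow_char 2 s e, sum_pow_char 2 s]
    exact Finset.sum_congr rfl fun i _ => by ring
  rw [map_sum, h4]
  exact Finset.sum_congr rfl fun i hi => (coeff_translatedFactor (hde i hi) (hq i hi) (hφ i hi)).2.2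

include hde hq hφ in
/-- `T₄ = [t⁴]Φ`, `T₆ = [t⁶]Φ` in closed form. [folklore] -/
theorem coeff_four_six_translatedSum :
    coeff 4 (∑ i ∈ s, φ i) = ∑ i ∈ s, (e i ^ 5 + x i ^ 2 * e i ^ 4 + (x i ^ 2) ^ 2 * e i ^ 3 + (1 + y i ^ 2) * e i ^ 2) ∧
      coeff 6 (∑ i ∈ s, φ i) = ∑ i ∈ s, (e i ^ 7 + x i ^ 2 * e i ^ 6 + ((x i ^ 2) ^ 3 + 1 + y i ^ 2) * e i ^ 4 + (x i ^ 2) ^ 2 * e i ^ 2) := by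
  constructor
  · rw [map_sum]; exact Finset.sum_congr rfl fun i hi => (coeff_four_six_translatedFactor (hde i hi) (hq i hi) (hφ i hi)).1
  · rw [map_sum]; exact Finset.sum_congr rfl fun i hi => (coeff_four_six_translatedFactor (hde i hi) (hq i hi) (hφ i hi)).2

end Sum

/-! ## §3–4 Levels `0` and `1` for `S₀ = λΦ(λt) + λ²Φ(λ²t)` -/

section Levels

variable {ι : Type*} {s : Finset ι} {x y d e : ι → R} {q φ : ι → R⟦X⟧}
  (hde : ∀ i ∈ s, d i * e i = 1)
  (hq : ∀ i ∈ s, q i * (X + C (x i) * (⟨0, 0, 1, 0, 0⟩ : WeierstrassCurve R).formalW) ^ 2 =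
    (⟨0, 0, 1, 0, 0⟩ : WeierstrassCurve R).formalW * (1 + C (x i ^ 2) * X + C (y i ^ 2) * (⟨0, 0, 1, 0, 0⟩ : WeierstrassCurve R).formalW))
  (hφ : ∀ i ∈ s, φ i * (C (d i) + q i) = 1)
  {l : R} (hl : l ^ 2 + l + 1 = 0)

include hde hq hφ hl

/-- **Level `0` for the honest `𝔣₀ ≠ 1` Robert function (stub J3, unweighted: no convention caveat).**  `S₀' = S₀²`; `[t⁰]S₀ = E₀ = Σᵢeᵢ`;
`E₀ ≠ 0 ⟹ [t⁰]S₀ ≠ 0` (`v(S₀) = 0`, `NonDeg(0)`); `E₀ = 0 ⟹ t⁴ ∣ S₀`. [folklore] -/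
theorem levelZero_translatedRobert :
    d⁄dX R (C l * rescale l (∑ i ∈ s, φ i) + C (l ^ 2) * rescale (l ^ 2) (∑ i ∈ s, φ i)) =
        (C l * rescale l (∑ i ∈ s, φ i) + C (l ^ 2) * rescale (l ^ 2) (∑ i ∈ s, φ i)) *
          (C l * rescale l (∑ i ∈ s, φ i) + C (l ^ 2) * rescale (l ^ 2) (∑ i ∈ s, φ i)) ∧
      coeff 0 (C l * rescale l (∑ i ∈ s, φ i) + C (l ^ 2) * rescale (l ^ 2) (∑ i ∈ s, φ i)) = ∑ i ∈ s, e i ∧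
      (∑ i ∈ s, e i ≠ 0 → coeff 0 (C l * rescale l (∑ i ∈ s, φ i) + C (l ^ 2) * rescale (l ^ 2) (∑ i ∈ s, φ i)) ≠ 0) ∧
      (∑ i ∈ s, e i = 0 → (X : R⟦X⟧) ^ 4 ∣ C l * rescale l (∑ i ∈ s, φ i) + C (l ^ 2) * rescale (l ^ 2) (∑ i ∈ s, φ i)) := by
  have hD := rhoSymm_levelZero_dichotomy hl (∑ i ∈ s, φ i) (coeff_zero_translatedSum hde hq hφ) (coeff_one_translatedSum hde hq hφ)
    (coeff_three_translatedSum hde hq hφ)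
  refine ⟨riccati_rhoSymm l (derivative_translatedSum hq hφ), ?_, hD.1, hD.2⟩
  rw [coeff_rhoSymm_eq hl, coeff_zero_translatedSum hde hq hφ]; simp

variable {δ : R⟦X⟧} {u : R} (hδ : (X : R⟦X⟧) ^ 8 ∣ δ - C u * X ^ 4)

include hδ

/-- **Level `1` for the honest `𝔣₀ ≠ 1` Robert function on `E₀ = 0` (stub J4).**  With `δ ≡ ūt⁴ (mod t⁸)` and `S₁ = S₀ + S₀(t + δ)`:
`t¹² ∣ S₁`, `[t¹²]S₁ = ūT₄² + ū²T₆`, `[t¹³]S₁ = 0`, and `ūT₄² + ū²T₆ = 0 ⟹ t¹⁴ ∣ S₁`, where `T₄ = Σᵢ(eᵢ⁵ + aᵢeᵢ⁴ + aᵢ²eᵢ³ + (1+bᵢ)eᵢ²)`,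
`T₆ = Σᵢ(eᵢ⁷ + aᵢeᵢ⁶ + (aᵢ³+1+bᵢ)eᵢ⁴ + aᵢ²eᵢ²)`, `aᵢ = xᵢ²`, `bᵢ = yᵢ²`. [folklore] -/
theorem levelOne_translatedRobert (hE : ∑ i ∈ s, e i = 0) :
    (X : R⟦X⟧) ^ 12 ∣ (C l * rescale l (∑ i ∈ s, φ i) + C (l ^ 2) * rescale (l ^ 2) (∑ i ∈ s, φ i)) +
        (C l * rescale l (∑ i ∈ s, φ i) + C (l ^ 2) * rescale (l ^ 2) (∑ i ∈ s, φ i)).subst (X + δ) ∧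
      coeff 12 ((C l * rescale l (∑ i ∈ s, φ i) + C (l ^ 2) * rescale (l ^ 2) (∑ i ∈ s, φ i)) +
          (C l * rescale l (∑ i ∈ s, φ i) + C (l ^ 2) * rescale (l ^ 2) (∑ i ∈ s, φ i)).subst (X + δ)) =
        u * (∑ i ∈ s, (e i ^ 5 + x i ^ 2 * e i ^ 4 + (x i ^ 2) ^ 2 * e i ^ 3 + (1 + y i ^ 2) * e i ^ 2)) ^ 2 +
          u ^ 2 * ∑ i ∈ s, (e i ^ 7 + x i ^ 2 * e i ^ 6 + ((x i ^ 2) ^ 3 + 1 + y i ^ 2) * e i ^ 4 + (x i ^ 2) ^ 2 * e i ^ 2) ∧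
      coeff 13 ((C l * rescale l (∑ i ∈ s, φ i) + C (l ^ 2) * rescale (l ^ 2) (∑ i ∈ s, φ i)) +
          (C l * rescale l (∑ i ∈ s, φ i) + C (l ^ 2) * rescale (l ^ 2) (∑ i ∈ s, φ i)).subst (X + δ)) = 0 ∧
      (u * (∑ i ∈ s, (e i ^ 5 + x i ^ 2 * e i ^ 4 + (x i ^ 2) ^ 2 * e i ^ 3 + (1 + y i ^ 2) * e i ^ 2)) ^ 2 +
          u ^ 2 * ∑ i ∈ s, (e i ^ 7 + x i ^ 2 * e i ^ 6 + ((x i ^ 2) ^ 3 + 1 + y i ^ 2) * e i ^ 4 + (x i ^ 2) ^ 2 * e i ^ 2) = 0 →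
        (X : R⟦X⟧) ^ 14 ∣ (C l * rescale l (∑ i ∈ s, φ i) + C (l ^ 2) * rescale (l ^ 2) (∑ i ∈ s, φ i)) +
          (C l * rescale l (∑ i ∈ s, φ i) + C (l ^ 2) * rescale (l ^ 2) (∑ i ∈ s, φ i)).subst (X + δ)) := by
  have hZ := levelZero_translatedRobert hde hq hφ hl
  have hR := hZ.1
  have h0 : coeff 0 (C l * rescale l (∑ i ∈ s, φ i) + C (l ^ 2) * rescale (l ^ 2) (∑ i ∈ s, φ i)) = 0 := by rw [hZ.2.1, hE]
  have h2 : coeff 2 (C l * rescale l (∑ i ∈ s, φ i) + C (l ^ 2) * rescale (l ^ 2) (∑ i ∈ s, φ i)) = 0 := by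
    rw [coeff_rhoSymm_eq hl]; simp
  have h46 := coeff_four_six_translatedSum hde hq hφ
  have hT4 : coeff 4 (C l * rescale l (∑ i ∈ s, φ i) + C (l ^ 2) * rescale (l ^ 2) (∑ i ∈ s, φ i)) =
      ∑ i ∈ s, (e i ^ 5 + x i ^ 2 * e i ^ 4 + (x i ^ 2) ^ 2 * e i ^ 3 + (1 + y i ^ 2) * e i ^ 2) := by
    rw [coeff_rhoSymm_eq hl, h46.1]; simp
  have hT6 : coeff 6 (C l * rescale l (∑ i ∈ s, φ i) + C (l ^ 2) * rescale (l ^ 2) (∑ i ∈ s, φ i)) =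
      ∑ i ∈ s, (e i ^ 7 + x i ^ 2 * e i ^ 6 + ((x i ^ 2) ^ 3 + 1 + y i ^ 2) * e i ^ 4 + (x i ^ 2) ^ 2 * e i ^ 2) := by
    rw [coeff_rhoSymm_eq hl, h46.2]; simp
  have hW := levelOne_dichotomy hR h0 h2 hδ
  refine ⟨hW.1, ?_, coeff_thirteen_levelOne hR h0 h2 hδ, fun hz => hW.2.2 (by rw [hT4, hT6]; exact hz)⟩
  rw [coeff_twelve_levelOne hR h0 h2 hδ, hT4, hT6]

end Levels

end Summit.BirchSwinnertonDyer.BirchSwinnertonDyer.Theorems.SignedMuAtTwo.JetCharacterSums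

end
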